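import Summits.BirchSwinnertonDyer.BirchSwinnertonDyer.Theorems.EisensteinPrimesMazurMCOnX1RankZeroDeepWitness
import Literature.NumberTheory.EllipticCurves.Rank1Residual.X1ThreeDescentCertificate
import Literature.NumberTheory.EllipticCurves.Rank1Residual.X1RankZeroCertificate
import Mathlib.NumberTheory.MulChar.Basic
import HarnessLib

/-!
# Crux idea g20 — the FIRST-DESCENT SHADOW at every X1 prime (bsd-eis-idea g20; crux
`stmt-BirchSwinnertonDyer-19035`, decl
`Summit.BirchSwinnertonDyer.BirchSwinnertonDyer.Theses.EisensteinPrimes.MazurMCOnX1RankZero`)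

LENS (anomaly-harvest / wuc at the analytic end, p-generic). g12's cubic Rédei typing
(`CubicRedei.*`, `p = 3`, twins with `#W(ℚ)_tors = 3`, `#W'(ℚ)_tors = 1`) is re-typed for an arbitrary
X1 prime `p` and an arbitrary ÉTALE STEP `W → W'` of a θ = 1 class (`#W(ℚ)_tors = p · #W'(ℚ)_tors`; this
admits torsion `6 → 2`, `10 → 2`, `15 → 5 / 3`, `14 → 2`, … and the steps of `9`- and `25`-chains), and
three p-generic laws are typed against the census F-g20-1 (Cremona `N < 5·10⁵`, `p ∈ {3 (semistable), 5, 7}`: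
5397 étale `p`-isogenies in 4805 rank-`0` θ = 1 classes, of which 5029 are étale STEPS in the typed sense
(torsion order drops by `p`; `p = 3`: 4688, `p = 5`: 317, `p = 7`: 24; the other 368 are the upper links
of `p²`-chains, e.g. `11a3 → 11a1`) — there is no θ = 1 class at `p = 13`). Sorting of the bad primes `ℓ ∣ N` of `W` (all multiplicative; decidable from the two minimal
discriminants, validated 5397/5397 against Cremona's `∏ c_ℓ` for BOTH curves and against the Cassels
identity `v' − v = t* − κ + 1 − 2(v_p T − v_p T')`):
* TAMAGAWA `T`: `v_ℓ(Δ_W) = p·v_ℓ(Δ_{W'})` (split, `P ∉ W⁰(ℚ_ℓ)`, `c_ℓ(W) = p·c_ℓ(W')`);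
* KUMMER `K`: `v_ℓ(Δ_{W'}) = p·v_ℓ(Δ_W)`, `ℓ ≡ 1 (mod p)` (split, `P ∈ W⁰(ℚ_ℓ)`);
* INERT: `v_ℓ(Δ_{W'}) = p·v_ℓ(Δ_W)`, non-split (then `ℓ ≡ −1 (mod p)`; census: no exception).
`κ = #K`, `t* = #T`, `ρ = rank_{𝔽_p} (χ_k(ℓ))_{k ∈ K, ℓ ∈ T}` (`p`-th power residue symbols), `s = κ − ρ`
(`= shadowDimAt`, character form as in g12), `t = t* − κ` (`= tamExcessAt`).
PROVED SHAPE (first `p`-isogeny descent with Schaefer–Stoll local images; support item below):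
`dim_{𝔽_p} Ш(W)[φ] = s`, `dim_{𝔽_p} Ш(W')[φ̂] = s + t − 1`; with Kato–Wuthrich `#Ш ∣ #Ш_an` and Cassels–Tate:
`v := v_p #Ш_an(W) ≥ 2⌈s/2⌉`, `v' ≥ 2⌈(s+t−1)/2⌉` (census C0: 5029/5029 steps).

CENSUS FACTS (F-g20-1; `fals/shadow-p357.tsv`, sha256[:16] in the memo):
(E1) MINIMAL STRATUM `(t,s) = (1,0)`: `v = v' = 0` in 4253/4253 steps (`p = 3`: 4030, `p = 5`: 217, `p = 7`: 6)
     — g12's R1 re-found at `p = 3` and NEW at `p = 5, 7`;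
(E2) RESIDUE-FREE steps (`K = ∅` and no Tamagawa prime `≡ 1 (mod p)`): `v = 0` in 1068/1068 steps incl. 134
     NON-minimal ones (`#T = 3`: `p = 3`: 57, `p = 5`: 62, `p = 7`: 15; there `p² ∣ #Ш_an(W')`) — NEW (not a
     g12 stratum);
(E3) CAP `v ≤ 2s + t − 1` (`= dim Sel^φ(W) + dim Sel^{φ̂}(W') − 1`): 5029/5029 — g12's K4 at every prime;
(E4) EXACTNESS `v = 2⌈s/2⌉`: 5005 of the 5029 steps; all 24 exceptions are `p = 3`, `(#T,κ,ρ) = (3,0,0)`,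
     `v = 2 = 2⌈s/2⌉ + 2`, each with a Tamagawa prime `≡ 1 (mod 3)` (so none is residue-free): 22 of them are
     the lower links of `9`-chains (source = middle curve, the extra plane comes through the upper link), and
     exactly TWO are twins — `58646f1`, `376402f1` — i.e. a Cassels–Tate-DEGENERATE second layer
     (`Ш(W)[p]/Ш(W)[φ] ≅ φ̂-image of rad CT|_{Ш(W')[φ̂]}`, here a plane) at the étale end: 2 of the 212 twin steps at
     `p = 3` where a residue symbol is available, 0 of 25 at `p = 5`. In range the `p`-part of `#Ш_an` at an
     étale source never involves `ℤ/p²` (E3).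
Typed below (all `def … : Prop`, no axiom, no sorry): the decidable data (`IsEtaleStepAt`, `tamPrimesAt`,
`kumPrimesAt`, `kumModulusAt`, `tamExcessAt`, `shadowDimAt`, `ResidueFree`), the laws
`MinimalStratumUnitLaw` (E1), `ResidueFreeUnitLaw` (E2), `EtaleShadowCap` (E3), the supports
`MinimalStratumShaTrivial` (S1, both members; first descent only) and `ResidueFreeShaTrivial` (S2, the algebraic
shadow of E2), and PROVED compositions: each unit law ⟹ `MazurMainConjecture W p` on its stratum (via
`Rank1ResidualX1Converse.mazurMainConjecture_of_shaAn_unit`), unit law + support ⟹ `BSDp W p` through the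
Literature door `X1.bsdp_of_noPTorsion` (GZK only), and (laws + the crux off the two strata) ⟹ the crux BY NAME.
-/

set_option linter.dupNamespace false
set_option autoImplicit false

noncomputable section

open scoped Classical
open WeierstrassCurve Literature.NumberTheory.EllipticCurves
  Literature.NumberTheory.EllipticCurves.Rank1Residual
  Literature.NumberTheory.EllipticCurves.Greenberg1999
  Summit.BirchSwinnertonDyer.BirchSwinnertonDyer.Theorems.Rank1ResidualX1Defs
  Summit.BirchSwinnertonDyer.BirchSwinnertonDyer.Theorems.Rank1ResidualX1Converse

namespace Summit.BirchSwinnertonDyer.BirchSwinnertonDyer.Cruxes.MazurMCOnX1RankZero.FirstDescentShadow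

/-! ## §0. Decidable data of an étale step `W → W'` at the prime `p` -/

section Data

variable (W W' : WeierstrassCurve ℚ) [W.IsGloballyMinimal] [W'.IsGloballyMinimal] (p : ℕ)

/-- `v_ℓ(Δ_min)` (as in g12's `CubicRedei.vDisc`; the crux workfile `CubicRedeiSketch` is not a built
module, so the two data definitions are repeated verbatim rather than imported). -/
def vDisc (W : WeierstrassCurve ℚ) [W.IsGloballyMinimal] (ℓ : ℕ) : ℕ :=
  padicValInt ℓ W.minimalDiscriminantInt

/-- Bad primes of a globally minimal model: the prime support of `Δ_min` (as g12's `CubicRedei.badPrimes`). -/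
def badPrimes (W : WeierstrassCurve ℚ) [W.IsGloballyMinimal] : Finset ℕ :=
  W.minimalDiscriminantInt.natAbs.primeFactors

/-- `W → W'` is an ÉTALE `p`-STEP of a θ = 1 class: `ℚ`-isogenous, `#W(ℚ)_tors = p · #W'(ℚ)_tors`
(the kernel is the rational subgroup of order `p`; `p ∣ #W(ℚ)_tors` follows), and at every bad prime of `W`
the two minimal discriminants are in ratio `p^{±1}` (Tate-curve bookkeeping). g12's `IsThreeTwin` is the
case `p = 3`, `#W'(ℚ)_tors = 1`. -/
def IsEtaleStepAt : Prop :=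
  IsIsogenous W W' ∧ W.torsionOrder = p * W'.torsionOrder ∧
    ∀ ℓ ∈ badPrimes W, vDisc W ℓ = p * vDisc W' ℓ ∨ vDisc W' ℓ = p * vDisc W ℓ

/-- TAMAGAWA primes of the step: `v_ℓ(Δ_W) = p · v_ℓ(Δ_{W'})`. -/
def tamPrimesAt : Finset ℕ := (badPrimes W).filter fun ℓ => vDisc W ℓ = p * vDisc W' ℓ

/-- KUMMER primes of the step: `v_ℓ(Δ_{W'}) = p · v_ℓ(Δ_W)` and `ℓ ≡ 1 (mod p)`. -/
def kumPrimesAt : Finset ℕ := (badPrimes W).filter fun ℓ => vDisc W' ℓ = p * vDisc W ℓ ∧ ℓ % p = 1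

/-- Kummer modulus `∏_{ℓ ∈ K} ℓ` (`= 1` when `K = ∅`). -/
def kumModulusAt : ℕ := ∏ ℓ ∈ kumPrimesAt W W' p, ℓ

/-- Tamagawa excess `t := #T − #K` (`= v_p(∏ c(W)) − v_p(∏ c(W'))`). -/
def tamExcessAt : ℤ := ((tamPrimesAt W W' p).card : ℤ) - (kumPrimesAt W W' p).card

/-- SHADOW DIMENSION `s := log_p #{χ mod ∏K of order ∣ p, trivial on every Tamagawa prime}`
`= κ − rank_{𝔽_p}(χ_k(ℓ)) = dim_{𝔽_p} Sel^{φ}(W/ℚ)` (class field theory + Schaefer–Stoll local images). -/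
def shadowDimAt : ℕ :=
  Nat.log p (Nat.card {χ : MulChar (ZMod (kumModulusAt W W' p)) ℂ //
    χ ^ p = 1 ∧ ∀ ℓ ∈ tamPrimesAt W W' p, χ (ℓ : ZMod (kumModulusAt W W' p)) = 1})

/-- RESIDUE-FREE step: no Kummer prime and no Tamagawa prime `≡ 1 (mod p)` — no `p`-th power residue
symbol is available to the second descent (no tame character of order `p` unramified outside the bad
primes can enter). Contains g12's LONELY case (`#T = 1`, `K = ∅`, `ℓ₀ ≢ 1`) but also `#T = 3, 5, …`. -/
def ResidueFree : Prop :=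
  kumPrimesAt W W' p = ∅ ∧ ∀ ℓ ∈ tamPrimesAt W W' p, ℓ % p ≠ 1

end Data

/-! ## §1. The laws (CONJECTURAL REGULARITIES, class-wide, refutable by one Cremona-type row) -/

/-- **G20-L1 — MINIMAL-STRATUM UNIT LAW at every X1 prime** (g12's R1 made p-generic): an étale step of a
semistable rank-`0` X1 class with `t = 1`, `s = 0` has `p ∤ #Ш_an(W)`, i.e.
`v_p(L(W,1)/Ω_W) = v_p(∏_ℓ c_ℓ(W)) − 2·v_p(#W(ℚ)_tors)`. Census F-g20-1: 4253/4253 (`p = 3`: 4030,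
`p = 5`: 217, `p = 7`: 6). On this stratum `Ш(W)[p^∞] = Ш(W')[p^∞] = 0` is a THEOREM of the first descent
(`MinimalStratumShaTrivial`), so the law is exactly the class-wide content of the crux there. Why it might
fail as a line: the only engines for a class-wide `L`-value non-divisibility at an Eisenstein prime are the
Eisenstein congruence of `f_W` modulo `𝔪²` (in print at ≤ two-prime level) or the main conjecture itself. -/
def MinimalStratumUnitLaw : Prop :=
  ∀ (W W' : WeierstrassCurve ℚ) [W.IsElliptic] [W.IsGloballyMinimal] [W'.IsElliptic]
    [W'.IsGloballyMinimal] (p : ℕ) [Fact p.Prime],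
    ClassX1 W p → W.analyticRank = 0 → Semistable W → IsEtaleStepAt W W' p →
    tamExcessAt W W' p = 1 → shadowDimAt W W' p = 0 →
    ∃ q : ℚ, shaAn W = (q : ℂ) ∧ padicValRat p q = 0

/-- **G20-L2 — RESIDUE-FREE UNIT LAW**: a residue-free étale step of a semistable rank-`0` X1 class has
`p ∤ #Ш_an(W)` — whatever the Tamagawa excess `t`. Census F-g20-1: 1068/1068 steps
(`p = 3`: 976, `p = 5`: 76, `p = 7`: 16), of which 134 have `t = 3` (there `p² ∣ #Ш_an(W')` while
`p ∤ #Ш_an(W)`). NEW relative to g12 (whose strata are cut by `(t,s)` only). Mechanism behind it: with no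
tame order-`p` character available, the Cassels–Tate pairing on `Ш(W')[φ̂]` should be RIGIDLY
nondegenerate (second descent without free parameters) — if that is a theorem (van Beek–Fisher-type CT
formula for `μ_p`-kernels), the law reduces to L1's analytic statement on a larger stratum; why it might
fail: a CT-degenerate residue-free step (none in range; the two CT-degenerate steps in range,
`58646f1`/`376402f1`, both carry a Tamagawa prime `≡ 1 (mod 3)`). -/
def ResidueFreeUnitLaw : Prop :=
  ∀ (W W' : WeierstrassCurve ℚ) [W.IsElliptic] [W.IsGloballyMinimal] [W'.IsElliptic]
    [W'.IsGloballyMinimal] (p : ℕ) [Fact p.Prime],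
    ClassX1 W p → W.analyticRank = 0 → Semistable W → IsEtaleStepAt W W' p →
    ResidueFree W W' p →
    ∃ q : ℚ, shaAn W = (q : ℂ) ∧ padicValRat p q = 0

/-- **G20-L3 — ÉTALE SHADOW CAP at every X1 prime** (g12's K4 made p-generic):
`v_p #Ш_an(W) ≤ 2s + t − 1 = dim Sel^{φ}(W) + dim Sel^{φ̂}(W') − 1`. Census F-g20-1: 5029/5029, with
`v_p #Ш_an(W) = 2⌈s/2⌉` in 5005 of the 5029 steps (the 24 exceptions, all `+2` at `p = 3`, in (E4) above).
Under `BSD(W,p)` it says `Ш(W)[p^∞]` is killed by `p` (no `ℤ/p²` at the étale end); NOT implied by BSD. -/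
def EtaleShadowCap : Prop :=
  ∀ (W W' : WeierstrassCurve ℚ) [W.IsElliptic] [W.IsGloballyMinimal] [W'.IsElliptic]
    [W'.IsGloballyMinimal] (p : ℕ) [Fact p.Prime],
    ClassX1 W p → W.analyticRank = 0 → Semistable W → IsEtaleStepAt W W' p →
    ∃ q : ℚ, shaAn W = (q : ℂ) ∧
      padicValRat p q ≤ 2 * (shadowDimAt W W' p : ℤ) + tamExcessAt W W' p - 1

/-! ## §2. Support (THEOREM of the literature, to be proved): first descent on the minimal stratum -/

/-- **G20-S1 — MINIMAL STRATUM ⟹ `Ш[p] = 0` AT BOTH MEMBERS** (Cassels 1965 VIII; Schaefer–Stoll 2004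
local images; DeLong 2002 / Cohen–Pazuki 2009 at `p = 3`): `t = 1`, `s = 0` ⟹ `Sel^{φ}(W) = 0`,
`Sel^{φ̂}(W') = ⟨δP⟩`, hence `Ш(W)[p] = 0` and `Ш(W')[p] = 0`. g12's `FirstDescentTrivial` is the
`W`-half at `p = 3`. -/
def MinimalStratumShaTrivial : Prop :=
  ∀ (W W' : WeierstrassCurve ℚ) [W.IsElliptic] [W.IsGloballyMinimal] [W'.IsElliptic]
    [W'.IsGloballyMinimal] (p : ℕ) [Fact p.Prime],
    W.HasGoodReductionAtPrime p → Semistable W → IsEtaleStepAt W W' p →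
    tamExcessAt W W' p = 1 → shadowDimAt W W' p = 0 →
    (∀ x : W.sha, ((p : ℕ) : ℤ) • x = 0 → x = 0) ∧ (∀ x : W'.sha, ((p : ℕ) : ℤ) • x = 0 → x = 0)

/-- **G20-S2 — RESIDUE-FREE ⟹ `Ш(W)[p] = 0`** (the ALGEBRAIC shadow of L2; conjectural beyond the minimal
stratum, where it is S1). On a residue-free step `Sel^{φ}(W) = Ш(W)[φ] = 0` (no Kummer prime) and the claim is that
the Cassels–Tate pairing on `Ш(W')[φ̂]` (dimension `t − 1`) is non-degenerate, i.e. `φ̂(Ш(W')[φ̂]) = Ш(W)[p] = 0`.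
In Cremona's range it HOLDS at all 1068 residue-free steps as a consequence of the closed per-pair cells (`v = 0` and
`BSD(W,p)` ⟹ `Ш(W)[p^∞] = 0`); Magma-checkable independently of L-values (data ask DA-g20-2). Why it might fail: a
residue-free step with `t ≥ 3` and CT-isotropic `Ш(W')[φ̂]` — none in range. -/
def ResidueFreeShaTrivial : Prop :=
  ∀ (W W' : WeierstrassCurve ℚ) [W.IsElliptic] [W.IsGloballyMinimal] [W'.IsElliptic]
    [W'.IsGloballyMinimal] (p : ℕ) [Fact p.Prime],
    W.HasGoodReductionAtPrime p → Semistable W → IsEtaleStepAt W W' p → ResidueFree W W' p →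
    ∀ x : W.sha, ((p : ℕ) : ℤ) • x = 0 → x = 0

/-! ## §3. Kernel-checked compositions -/

/-- **L1 ⟹ the crux's conclusion on the minimal stratum, at every X1 prime.** -/
theorem mazurMainConjecture_of_minimalStratumUnitLaw (hW : Wuthrich2014.sha_dvd_analyticSha)
    (hW16 : Wuthrich2014.charIdeal_dvd_padicLFunction) (hGr : greenberg_charValue_rankZero)
    (hGZK : rank_eq_analyticRank_of_analyticRank_le_one) (hmod : hasEntireLFunction_rat)
    (hL1 : MinimalStratumUnitLaw)
    (W W' : WeierstrassCurve ℚ) [W.IsElliptic] [W.IsGloballyMinimal] [W'.IsElliptic]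
    [W'.IsGloballyMinimal] (p : ℕ) [Fact p.Prime]
    (hX1 : ClassX1 W p) (hr0 : W.analyticRank = 0) (hss : Semistable W) (hst : IsEtaleStepAt W W' p)
    (ht : tamExcessAt W W' p = 1) (hs : shadowDimAt W W' p = 0) : MazurMainConjecture W p := by
  have hL : W.entireLFunction 1 ≠ 0 := (W.analyticRank_eq_zero_iff_holds (hmod W)).mp hr0
  exact mazurMainConjecture_of_shaAn_unit hW hW16 hGr hGZK W p hX1 hL (hL1 W W' p hX1 hr0 hss hst ht hs)

/-- **L2 ⟹ the crux's conclusion on the residue-free stratum, at every X1 prime.** -/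
theorem mazurMainConjecture_of_residueFreeUnitLaw (hW : Wuthrich2014.sha_dvd_analyticSha)
    (hW16 : Wuthrich2014.charIdeal_dvd_padicLFunction) (hGr : greenberg_charValue_rankZero)
    (hGZK : rank_eq_analyticRank_of_analyticRank_le_one) (hmod : hasEntireLFunction_rat)
    (hL2 : ResidueFreeUnitLaw)
    (W W' : WeierstrassCurve ℚ) [W.IsElliptic] [W.IsGloballyMinimal] [W'.IsElliptic]
    [W'.IsGloballyMinimal] (p : ℕ) [Fact p.Prime]
    (hX1 : ClassX1 W p) (hr0 : W.analyticRank = 0) (hss : Semistable W) (hst : IsEtaleStepAt W W' p)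
    (hrf : ResidueFree W W' p) : MazurMainConjecture W p := by
  have hL : W.entireLFunction 1 ≠ 0 := (W.analyticRank_eq_zero_iff_holds (hmod W)).mp hr0
  exact mazurMainConjecture_of_shaAn_unit hW hW16 hGr hGZK W p hX1 hL (hL2 W W' p hX1 hr0 hss hst hrf)

/-- **L1 + S1 ⟹ `BSD(W,p)` on the minimal stratum** through the Literature door `X1.bsdp_of_noPTorsion`
(Gross–Zagier–Kolyvagin finiteness only — no `hW16`/`hGr`): the first-descent certificate made class-wide. -/
theorem bsdp_of_minimalStratumUnitLaw_of_shaTrivial (hGZK : rank_eq_analyticRank_of_analyticRank_le_one)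
    (hL1 : MinimalStratumUnitLaw) (hS1 : MinimalStratumShaTrivial)
    (W W' : WeierstrassCurve ℚ) [W.IsElliptic] [W.IsGloballyMinimal] [W'.IsElliptic]
    [W'.IsGloballyMinimal] (p : ℕ) [Fact p.Prime]
    (hX1 : ClassX1 W p) (hr0 : W.analyticRank = 0) (hss : Semistable W) (hst : IsEtaleStepAt W W' p)
    (ht : tamExcessAt W W' p = 1) (hs : shadowDimAt W W' p = 0) : BSDp W p := by
  obtain ⟨q, hq, hv⟩ := hL1 W W' p hX1 hr0 hss hst ht hs
  have hgood : W.HasGoodReductionAtPrime p := (isClassX1_of_classX1 hX1).hasGoodReductionAtPrime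
  exact X1.bsdp_of_noPTorsion hGZK W p (by omega) hX1 hq hv (hS1 W W' p hgood hss hst ht hs).1

/-- **L2 + S2 ⟹ `BSD(W,p)` on the residue-free stratum**, same door. -/
theorem bsdp_of_residueFreeUnitLaw_of_shaTrivial (hGZK : rank_eq_analyticRank_of_analyticRank_le_one)
    (hL2 : ResidueFreeUnitLaw) (hS2 : ResidueFreeShaTrivial)
    (W W' : WeierstrassCurve ℚ) [W.IsElliptic] [W.IsGloballyMinimal] [W'.IsElliptic]
    [W'.IsGloballyMinimal] (p : ℕ) [Fact p.Prime]
    (hX1 : ClassX1 W p) (hr0 : W.analyticRank = 0) (hss : Semistable W) (hst : IsEtaleStepAt W W' p)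
    (hrf : ResidueFree W W' p) : BSDp W p := by
  obtain ⟨q, hq, hv⟩ := hL2 W W' p hX1 hr0 hss hst hrf
  have hgood : W.HasGoodReductionAtPrime p := (isClassX1_of_classX1 hX1).hasGoodReductionAtPrime
  exact X1.bsdp_of_noPTorsion hGZK W p (by omega) hX1 hq hv (hS2 W W' p hgood hss hst hrf)

/-- The two SHADOW STRATA of a pair `(W, p)`: `W` semistable with an étale step `W → W'` that is minimal
(`t = 1`, `s = 0`) or residue-free. Decidable from the two minimal models. -/
def OnShadowStrata (W : WeierstrassCurve ℚ) [W.IsGloballyMinimal] (p : ℕ) : Prop :=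
  Semistable W ∧ ∃ (W' : WeierstrassCurve ℚ) (_ : W'.IsElliptic) (_ : W'.IsGloballyMinimal),
    IsEtaleStepAt W W' p ∧
      ((tamExcessAt W W' p = 1 ∧ shadowDimAt W W' p = 0) ∨ ResidueFree W W' p)

/-- **L1 + L2 + (the crux OFF the two shadow strata) ⟹ the crux BY NAME.** Pure logic. -/
theorem mazurMCOnX1RankZero_of_unitLaws_of_offStrata
    (hW : Wuthrich2014.sha_dvd_analyticSha)
    (hW16 : Wuthrich2014.charIdeal_dvd_padicLFunction) (hGr : greenberg_charValue_rankZero)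
    (hGZK : rank_eq_analyticRank_of_analyticRank_le_one) (hmod : hasEntireLFunction_rat)
    (hL1 : MinimalStratumUnitLaw) (hL2 : ResidueFreeUnitLaw)
    (hOff : ∀ (W : WeierstrassCurve ℚ) [W.IsElliptic] [W.IsGloballyMinimal] (p : ℕ) [Fact p.Prime],
      ClassX1 W p → W.analyticRank = 0 → ¬ OnShadowStrata W p → MazurMainConjecture W p) :
    Summit.BirchSwinnertonDyer.BirchSwinnertonDyer.Theses.EisensteinPrimes.MazurMCOnX1RankZero := by
  intro W _ _ p _ hX1 hr0
  by_cases hS : OnShadowStrata W p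
  · obtain ⟨hss, W', _, _, hst, hstr⟩ := hS
    rcases hstr with ⟨ht, hs⟩ | hrf
    · exact mazurMainConjecture_of_minimalStratumUnitLaw hW hW16 hGr hGZK hmod hL1 W W' p hX1 hr0 hss
        hst ht hs
    · exact mazurMainConjecture_of_residueFreeUnitLaw hW hW16 hGr hGZK hmod hL2 W W' p hX1 hr0 hss hst hrf
  · exact hOff W p hX1 hr0 hS

/-- L3 ⟹ L1-shaped CAP `≤ 1` on the minimal stratum (sanity: the cap specialises correctly; with the parity
of `#Ш[p^∞]` — a square by Cassels–Tate — a prover turns `≤ 1` into `= 0`, cf. g12 K4 → K1). -/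
theorem cap_le_one_of_etaleShadowCap (hL3 : EtaleShadowCap)
    (W W' : WeierstrassCurve ℚ) [W.IsElliptic] [W.IsGloballyMinimal] [W'.IsElliptic]
    [W'.IsGloballyMinimal] (p : ℕ) [Fact p.Prime]
    (hX1 : ClassX1 W p) (hr0 : W.analyticRank = 0) (hss : Semistable W) (hst : IsEtaleStepAt W W' p)
    (ht : tamExcessAt W W' p = 1) (hs : shadowDimAt W W' p = 0) :
    ∃ q : ℚ, shaAn W = (q : ℂ) ∧ padicValRat p q ≤ 0 := by
  obtain ⟨q, hq, hv⟩ := hL3 W W' p hX1 hr0 hss hst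
  exact ⟨q, hq, by rw [ht, hs] at hv; simpa using hv⟩

end Summit.BirchSwinnertonDyer.BirchSwinnertonDyer.Cruxes.MazurMCOnX1RankZero.FirstDescentShadow
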